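import Literature.NumberTheory.K2Lit.LocalDoublingSiegel
import Literature.NumberTheory.K2Lit.LocalDoublingZeta
import Mathlib.GroupTheory.DoubleCoset
import HarnessLib

/-!
# Bi-`K_v`-invariance of `Λ_{s,v} ∘ ι_v`, Cartan ∕ spherical-Hecke carriers, the local scalar `c_v`, and factorizable global sections
# (leaf D7d of the LOCAL SEAM of s23)

Topic `NumberTheory/K2Lit` (Track B build stream 29; SPEC-D7 `K2/K2Liu-plan/g0/SPEC-D7-LocalDoublingZeta.v1.K2Liu-plan-g0.md` §0 (LS1′), §§4–6;
DEPMAP v2.1 `Cruxes/HLiu418/Lines/K2_Liu_LocalSeam_s23.md` §1 (a)–(c), files #26–#29). Sibling of ★ `K2Lit/LocalDoublingEmbedding` (`ι_v`), ★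
`K2Lit/LocalDoublingZeta` (`doublingHeckeOp`, `zetaS`), ★ `K2Lit/LocalDoublingSiegel` (`siegelDeltaLoc`, `siegelCharLoc`, `LambdaLoc`). Definitions with
bodies and proved theorems only: **no `sorry`, no named fact, no instance, no notation.**

* §5 `coe_iotaVLocPi_apply` — the `w`-component of `ι_v(x₁, x₂)` is the block matrix of the `w`-components; **`iotaVLocPi_mem_localInt`**:
  `ι_v(K_v × K_v) ≤ K_{H,v}`; **`iotaVLocPi_diag_mem_siegelDeltaLoc`**: `ι_v(k, k) ∈ P_Δ(L⁺_v)`, with `siegelCharLoc (ι_v(k,k)) = 1` for `k ∈ K_v`, `χ`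
  unramified above `v`.
* §6 **`g ↦ Λ_{s,v}(ι_v(g, 1))` is BI-`K_v`-INVARIANT** (`lambdaLoc_iotaLeft_mul_localInt`, `lambdaLoc_iotaLeft_localInt_mul`) — the HECKE FORM of the
  unramified computation rests on this: the kernel of ★ `doublingHeckeOp` is a (convergent) series of `K_v`-double-coset indicators (SPEC §0 (LS1′)).
* §7 generic carriers (any group `G`, subgroup `K`, Banach `V`): `IsCartanFamily K t` (`G = ⨆ K t_i K`, Mathlib `DoubleCoset.doubleCoset`),
  `IsSphericalHeckeEigen ν K t τ u ev` (`u` `K`-fixed, `∫_{K t_i K} τ(g) u dν = ev i • u`), **`cLoc t Λ ev := ∑' i, Λ(t i) · ev i`** and `CLocSummable` —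
  the EXPLICIT local scalar `c_v(s, t)` of file #28 once file #27 computes `Λ_{s,v}` on the Cartan representatives (nothing posited here).
* §8 **`IsFactorizableOff S χ f fS`**: `f_s(h) = fS_s(h_∞, (h_v)_{v∈S}) · ∏ᶠ_{v∉S} Λ_{s,v}(h_v)` (★ `archPart ∕ finPart ∕ evalPlace`); `finite_mulSupport_lambdaLoc`:
  the off-`S` product is finitely supported for `χ` unramified almost everywhere (★ `eventually_evalPlace_mem_localInt`).

Degenerate corners: as in ★ `LocalDoublingSiegel` (`χ` ramified above `v` ⇒ §§5–6 not claimed; the local Iwasawa decomposition is a socket-side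
binder, see that file's header); `S = ∅` allowed; `ι` (index of the Cartan family) arbitrary, `cLoc` junk `0` when not summable.
References: [Li1992, §3 Thm. 3.1]; [GelbartPiatetskishapiroRallis1987, Part A §1, §6]; [HarrisKudlaSweet1996, §1 (1.11)–(1.15)]; [Liu2011, §2B–§2C pp. 862–863];
[GelbartRogawski1991, §3.1 (3.1.3)]; [BorelJacquet1979, §4.1].
-/

set_option autoImplicit false

noncomputable section

open scoped Matrix
open NumberField IsDedekindDomain

namespace Literature.NumberTheory.K2Lit.SiegelDoubled

open Literature.NumberTheory.Automorphic Literature.NumberTheory.GaloisRepresentations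
open Literature.NumberTheory.GelbartRogawski1991 Literature.NumberTheory.GelbartRogawski1991.GRConstruction
open Literature.NumberTheory.GelbartRogawski1991.UnitaryDualPair

variable (L : Type) [Field L] [NumberField L] [IsCMField L]
variable {N M n : ℕ} (e : Fin N × Fin M ≃ Fin n)
  (dV : Fin N → L) (hdV : ∀ i, IsCMField.complexConj L (dV i) = dV i)
  (dW : Fin M → L) (hdW : ∀ i, IsCMField.complexConj L (dW i) = dW i)
  (v : HeightOneSpectrum (𝓞 (Fp L)))

/-! ## §5 Place components of `ι_v`; `ι_v(K_v × K_v) ≤ K_{H,v}`; `ι_v(k, k) ∈ P_Δ(L⁺_v)` -/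

section IotaIntegral

open scoped Kronecker

omit [IsCMField L] in
/-- entries of the block matrix of `ι` lie in any subring containing the entries of the two blocks. [cite: HarrisKudlaSweet1996, §1 (1.11)] -/
theorem iotaMatrix_apply_mem {R : Type} [CommRing R] (S : Subring R) {A B : Matrix (Fin N) (Fin N) R}
    (hA : ∀ i j, A i j ∈ S) (hB : ∀ i j, B i j ∈ S) (i j : Fin (n + n)) :
    (Matrix.reindex (e₂ (n := n)) (e₂ (n := n))
        (Matrix.fromBlocks (Matrix.reindex e e (A ⊗ₖ (1 : Matrix (Fin M) (Fin M) R))) 0 0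
          (Matrix.reindex e e (B ⊗ₖ (1 : Matrix (Fin M) (Fin M) R))))) i j ∈ S := by
  have hk : ∀ {C : Matrix (Fin N) (Fin N) R}, (∀ i j, C i j ∈ S) → ∀ a b : Fin n,
      Matrix.reindex e e (C ⊗ₖ (1 : Matrix (Fin M) (Fin M) R)) a b ∈ S := by
    intro C hC a b
    rw [Matrix.reindex_apply, Matrix.submatrix_apply, Matrix.kroneckerMap_apply, Matrix.one_apply]
    split_ifs
    · rw [mul_one]; exact hC _ _
    · rw [mul_zero]; exact S.zero_mem
  rw [Matrix.reindex_apply, Matrix.submatrix_apply]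
  rcases (e₂ (n := n)).symm i with i' | i' <;> rcases (e₂ (n := n)).symm j with j' | j'
  · rw [Matrix.fromBlocks_apply₁₁]; exact hk hA i' j'
  · rw [Matrix.fromBlocks_apply₁₂]; exact S.zero_mem
  · rw [Matrix.fromBlocks_apply₂₁]; exact S.zero_mem
  · rw [Matrix.fromBlocks_apply₂₂]; exact hk hB i' j'

/-- **the `w`-component of `ι_v(x₁, x₂)`** is the block matrix of the `w`-components: `reindex e₂ (diag (reindex e ((x₁)_w ⊗ 1), reindex e ((x₂)_w ⊗ 1)))`.
[cite: HarrisKudlaSweet1996, §1 (1.11)] [cite: Liu2011, §2C p. 863] -/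
theorem coe_iotaVLocPi_apply (x : UnitaryGroup.localPi L (IsCMField.complexConj L) N (Matrix.diagonal dV) v ×
      UnitaryGroup.localPi L (IsCMField.complexConj L) N (Matrix.diagonal dV) v) (w : UnitaryGroup.PlacesOver L v) :
    Units.val (((iotaVLocPi L e dV hdV dW hdW v x :
        UnitaryGroup.localPi L (IsCMField.complexConj L) (n + n) (hermD L e dV hdV dW hdW) v) :
          UnitaryGroup.LocalGLPi L (n + n) v) w) =
      Matrix.reindex (e₂ (n := n)) (e₂ (n := n))
        (Matrix.fromBlocks
          (Matrix.reindex e e (Units.val ((x.1 : UnitaryGroup.LocalGLPi L N v) w) ⊗ₖ (1 : Matrix (Fin M) (Fin M) (w.1.adicCompletion L))))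
          0 0
          (Matrix.reindex e e (Units.val ((x.2 : UnitaryGroup.LocalGLPi L N v) w) ⊗ₖ (1 : Matrix (Fin M) (Fin M) (w.1.adicCompletion L))))) := by
  change ((Units.val (Subtype.val (iotaVLoc L e dV hdV dW hdW v
      (UnitaryGroup.localPiEquiv L (IsCMField.complexConj L) N (Matrix.diagonal dV) v x.1,
        UnitaryGroup.localPiEquiv L (IsCMField.complexConj L) N (Matrix.diagonal dV) v x.2)))).map
      (Pi.evalRingHom (fun w : UnitaryGroup.PlacesOver L v => w.1.adicCompletion L) w)) = _
  rw [coe_iotaVLoc, iotaMatrix_map]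
  rfl

/-- **`ι_v(K_v × K_v) ≤ K_{H,v}`**: the doubling embedding carries integral points to integral points (entries of `ι_v(x₁, x₂)_w` are entries of
`(x₁)_w`, `(x₂)_w`, `0`, `1`). [cite: GelbartRogawski1991, §3.1 (3.1.3) p. 456] [cite: Li1992, §3] -/
theorem iotaVLocPi_mem_localInt
    {x : UnitaryGroup.localPi L (IsCMField.complexConj L) N (Matrix.diagonal dV) v ×
      UnitaryGroup.localPi L (IsCMField.complexConj L) N (Matrix.diagonal dV) v}
    (h1 : x.1 ∈ UnitaryGroup.localInt L (IsCMField.complexConj L) N (Matrix.diagonal dV) v)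
    (h2 : x.2 ∈ UnitaryGroup.localInt L (IsCMField.complexConj L) N (Matrix.diagonal dV) v) :
    iotaVLocPi L e dV hdV dW hdW v x ∈
      UnitaryGroup.localInt L (IsCMField.complexConj L) (n + n) (hermD L e dV hdV dW hdW) v := by
  rw [UnitaryGroup.mem_localInt_iff] at h1 h2 ⊢
  intro w
  have hw1 := (mem_glInt_iff _).1 (h1 w)
  have hw2 := (mem_glInt_iff _).1 (h2 w)
  rw [mem_glInt_iff]
  refine ⟨fun i j => ?_, fun i j => ?_⟩
  · rw [coe_iotaVLocPi_apply]
    exact iotaMatrix_apply_mem e _ (fun i j => hw1.1 i j) (fun i j => hw2.1 i j) i j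
  · have hinv : (((iotaVLocPi L e dV hdV dW hdW v x :
        UnitaryGroup.localPi L (IsCMField.complexConj L) (n + n) (hermD L e dV hdV dW hdW) v) :
          UnitaryGroup.LocalGLPi L (n + n) v) w)⁻¹ =
        ((iotaVLocPi L e dV hdV dW hdW v x⁻¹ :
          UnitaryGroup.localPi L (IsCMField.complexConj L) (n + n) (hermD L e dV hdV dW hdW) v) :
            UnitaryGroup.LocalGLPi L (n + n) v) w := by
      rw [map_inv]; rfl
    rw [hinv, coe_iotaVLocPi_apply]
    exact iotaMatrix_apply_mem e _ (fun i j => hw1.2 i j) (fun i j => hw2.2 i j) i j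

/-- **`ι_v(k, k) ∈ P_Δ(L⁺_v)`** (the diagonal `G^Δ` lies in the Siegel parabolic — local twin of ★ `isSiegelDelta_iotaV_diag`).
[cite: Liu2021, §B.3 p. 101] [cite: Kudla1994, §2] -/
theorem iotaVLocPi_diag_mem_siegelDeltaLoc (k : UnitaryGroup.localPi L (IsCMField.complexConj L) N (Matrix.diagonal dV) v) :
    iotaVLocPi L e dV hdV dW hdW v (k, k) ∈ siegelDeltaLoc L e dV hdV dW hdW v := by
  rw [mem_siegelDeltaLoc_iff_isSiegelM]
  intro w
  unfold IsSiegelM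
  rw [show ((((iotaVLocPi L e dV hdV dW hdW v (k, k) :
      UnitaryGroup.localPi L (IsCMField.complexConj L) (n + n) (hermD L e dV hdV dW hdW) v) :
        UnitaryGroup.LocalGLPi L (n + n) v) w : GL (Fin (n + n)) (w.1.adicCompletion L)) :
          Matrix (Fin (n + n)) (Fin (n + n)) (w.1.adicCompletion L)) = _ from coe_iotaVLocPi_apply L e dV hdV dW hdW v (k, k) w,
    ← Matrix.reindex_symm, Equiv.symm_apply_apply]
  simp only [Matrix.toBlocks_fromBlocks₁₁, Matrix.toBlocks_fromBlocks₁₂, Matrix.toBlocks_fromBlocks₂₁, Matrix.toBlocks_fromBlocks₂₂,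
    add_zero, zero_add]

/-- `siegelCharLoc χ v s (ι_v(k, k)) = 1` for `k ∈ K_v` and `χ` unramified above `v`. [cite: Li1992, §3] [cite: GelbartRogawski1991, §3.1 (3.1.3)] -/
theorem siegelCharLoc_iotaVLocPi_diag (χ : HeckeCharacter L) (s : ℂ) (hχ : ∀ w : UnitaryGroup.PlacesOver L v, χ.IsUnramifiedAt w.1)
    {k : UnitaryGroup.localPi L (IsCMField.complexConj L) N (Matrix.diagonal dV) v}
    (hk : k ∈ UnitaryGroup.localInt L (IsCMField.complexConj L) N (Matrix.diagonal dV) v) :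
    siegelCharLoc L e dV hdV dW hdW v χ s (iotaVLocPi L e dV hdV dW hdW v (k, k)) = 1 :=
  siegelCharLoc_eq_one_of_mem_localInt L e dV hdV dW hdW v χ s hχ (iotaVLocPi_diag_mem_siegelDeltaLoc L e dV hdV dW hdW v k)
    (iotaVLocPi_mem_localInt L e dV hdV dW hdW v hk hk)

/-! ## §6 `g ↦ Λ_{s,v}(ι_v(g, 1))` is bi-`K_v`-invariant -/

/-- **right `K_v`-invariance**: `Λ_{s,v}(ι_v(g k, 1)) = Λ_{s,v}(ι_v(g, 1))`. [cite: Li1992, §3] [cite: GelbartPiatetskishapiroRallis1987, Part A §6] -/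
theorem lambdaLoc_iotaLeft_mul_localInt (χ : HeckeCharacter L) (s : ℂ) (hχ : ∀ w : UnitaryGroup.PlacesOver L v, χ.IsUnramifiedAt w.1)
    (g : UnitaryGroup.localPi L (IsCMField.complexConj L) N (Matrix.diagonal dV) v)
    {k : UnitaryGroup.localPi L (IsCMField.complexConj L) N (Matrix.diagonal dV) v}
    (hk : k ∈ UnitaryGroup.localInt L (IsCMField.complexConj L) N (Matrix.diagonal dV) v) :
    LambdaLoc L e dV hdV dW hdW v χ s (iotaLeftLocPi L e dV hdV dW hdW v (g * k)) =
      LambdaLoc L e dV hdV dW hdW v χ s (iotaLeftLocPi L e dV hdV dW hdW v g) := by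
  rw [map_mul, iotaLeftLocPi_apply L e dV hdV dW hdW v k]
  exact lambdaLoc_mul_localInt L e dV hdV dW hdW v χ s hχ _
    (iotaVLocPi_mem_localInt L e dV hdV dW hdW v (x := (k, 1)) hk (one_mem _))

/-- **left `K_v`-invariance**: `Λ_{s,v}(ι_v(k g, 1)) = Λ_{s,v}(ι_v(g, 1))` — `ι_v(k g, 1) = ι_v(k, k)·ι_v(g, 1)·ι_v(1, k⁻¹)` with `ι_v(k, k) ∈ P_Δ` of
character `1` (§5) and `ι_v(1, k⁻¹) ∈ K_{H,v}`. [cite: Li1992, §3] [cite: GelbartPiatetskishapiroRallis1987, Part A §6] -/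
theorem lambdaLoc_iotaLeft_localInt_mul (χ : HeckeCharacter L) (s : ℂ) (hχ : ∀ w : UnitaryGroup.PlacesOver L v, χ.IsUnramifiedAt w.1)
    (g : UnitaryGroup.localPi L (IsCMField.complexConj L) N (Matrix.diagonal dV) v)
    {k : UnitaryGroup.localPi L (IsCMField.complexConj L) N (Matrix.diagonal dV) v}
    (hk : k ∈ UnitaryGroup.localInt L (IsCMField.complexConj L) N (Matrix.diagonal dV) v) :
    LambdaLoc L e dV hdV dW hdW v χ s (iotaLeftLocPi L e dV hdV dW hdW v (k * g)) =
      LambdaLoc L e dV hdV dW hdW v χ s (iotaLeftLocPi L e dV hdV dW hdW v g) := by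
  have hfac : iotaLeftLocPi L e dV hdV dW hdW v (k * g) =
      iotaVLocPi L e dV hdV dW hdW v (k, k) *
        (iotaLeftLocPi L e dV hdV dW hdW v g * iotaVLocPi L e dV hdV dW hdW v (1, k⁻¹)) := by
    rw [iotaLeftLocPi_apply, iotaLeftLocPi_apply, ← map_mul, ← map_mul, Prod.mk_mul_mk, Prod.mk_mul_mk, mul_one, one_mul,
      mul_inv_cancel]
  rw [hfac, lambdaLoc_siegel_mul L e dV hdV dW hdW v χ s hχ (iotaVLocPi_diag_mem_siegelDeltaLoc L e dV hdV dW hdW v k),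
    siegelCharLoc_iotaVLocPi_diag L e dV hdV dW hdW v χ s hχ hk, one_mul]
  exact lambdaLoc_mul_localInt L e dV hdV dW hdW v χ s hχ _
    (iotaVLocPi_mem_localInt L e dV hdV dW hdW v (x := (1, k⁻¹)) (one_mem _) (inv_mem hk))

end IotaIntegral

/-! ## §7 Cartan families, spherical Hecke eigenvectors and the local scalar `c_v` (generic carriers) -/

section Hecke

variable {G : Type} [Group G] [MeasurableSpace G] {ι : Type} {V : Type} [NormedAddCommGroup V] [NormedSpace ℂ V]

/-- **a Cartan family** `t : ι → G` for a subgroup `K`: `G = ⨆_i K t_i K` (every element lies in exactly one double coset).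
A `Prop` carrier — for `G_v = U(V)(L⁺_v)`, `K_v = U(V)(𝒪_v)` at a good place it is the Cartan decomposition proved by the Cartan file of the seam (#26).
[cite: GelbartPiatetskishapiroRallis1987, Part A §6] [cite: Li1992, §3] -/
def IsCartanFamily (K : Subgroup G) (t : ι → G) : Prop :=
  (∀ g : G, ∃ i, g ∈ DoubleCoset.doubleCoset (t i) (K : Set G) K) ∧
    ∀ i j, (DoubleCoset.doubleCoset (t i) (K : Set G) K ∩ DoubleCoset.doubleCoset (t j) (K : Set G) K).Nonempty → i = j

/-- **a `K`-spherical Hecke eigenvector** `u` of the action `τ` with eigenvalues `ev : ι → ℂ` along the family `t`: `u` is `K`-fixed and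
`∫_{K t_i K} τ(g) u dν = ev i • u` for every `i` (Bochner, in the Banach space `V`; the volume of the double coset is absorbed in `ev i`).
[cite: Li1992, §3 Thm. 3.1] [cite: GelbartPiatetskishapiroRallis1987, Part A §6] -/
def IsSphericalHeckeEigen (ν : MeasureTheory.Measure G) (K : Subgroup G) (t : ι → G) (τ : G → V →L[ℂ] V) (u : V)
    (ev : ι → ℂ) : Prop :=
  (∀ k ∈ K, τ k u = u) ∧
    ∀ i, MeasureTheory.IntegrableOn (fun g => τ g u) (DoubleCoset.doubleCoset (t i) (K : Set G) K) ν ∧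
      ∫ g in DoubleCoset.doubleCoset (t i) (K : Set G) K, τ g u ∂ν = ev i • u

/-- **the local scalar `c(Λ, t, ev) := ∑' i, Λ(t i) · ev i`** — for `Λ = Λ_{s,v} ∘ ι_v(·, 1)` (bi-`K_v`-invariant, §6) and a spherical Hecke
eigenvector this is the eigenvalue of the doubling Hecke operator ★ `doublingHeckeOp ν Λ τ` on `u` (file #28: `T(Λ) u = c • u`; `c_v(s, t)` EXPLICIT
once file #27 computes `Λ_{s,v}` on the Cartan representatives); junk `0` when not summable. [cite: Li1992, §3 Thm. 3.1] [cite: Liu2011, §2C (2-4) p. 863] -/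
def cLoc (t : ι → G) (Λ : G → ℂ) (ev : ι → ℂ) : ℂ :=
  ∑' i, Λ (t i) * ev i

/-- summability of the series defining `cLoc`. [cite: Li1992, §3 Thm. 3.1] -/
def CLocSummable (t : ι → G) (Λ : G → ℂ) (ev : ι → ℂ) : Prop :=
  Summable fun i => Λ (t i) * ev i

omit [Group G] [MeasurableSpace G] in
/-- `cLoc` of the zero kernel vanishes. [cite: Li1992, §3 Thm. 3.1] -/
theorem cLoc_zero (t : ι → G) (ev : ι → ℂ) : cLoc t (fun _ => (0 : ℂ)) ev = 0 := by
  simp [cLoc]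

omit [Group G] [MeasurableSpace G] in
/-- for a finitely supported family the series is a finite sum. [cite: Li1992, §3 Thm. 3.1] -/
theorem cLoc_eq_sum_of_support_subset (t : ι → G) (Λ : G → ℂ) (ev : ι → ℂ) (s : Finset ι)
    (hs : Function.support (fun i => Λ (t i) * ev i) ⊆ s) : cLoc t Λ ev = ∑ i ∈ s, Λ (t i) * ev i :=
  tsum_eq_sum' hs

end Hecke

/-! ## §8 Factorizable families of global sections off `S` (the bypass's substitute for `⊗′`) -/

section Factorizable

/-- **`f` is FACTORIZABLE OFF `S` through `fS`**: for every `s` and every `h ∈ H(𝔸)`,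
`f_s(h) = fS_s(h_∞, (h_v)_{v∈S}) · ∏ᶠ_{v∉S} Λ_{s,v}(h_v)` with the unramified local sections `Λ_{s,v}` of ★ `LambdaLoc` (components through ★
`UnitaryGroup.archPart ∕ finPart ∕ evalPlace`; the product is finitely supported for `χ` unramified almost everywhere, `finite_mulSupport_lambdaLoc`).
The HECKE BYPASS uses only such families: no restricted tensor product of local representations is formed. [cite: Liu2011, §2B p. 862] [cite: GelbartPiatetskishapiroRallis1987, Part A §1] -/
def IsFactorizableOff (S : Finset (HeightOneSpectrum (𝓞 (Fp L)))) (χ : HeckeCharacter L) (f : ℂ → HA L e dV hdV dW hdW → ℂ)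
    (fS : ℂ → UnitaryGroup.arch (Fp L) L (IsCMField.complexConj L) (n + n) (hermD L e dV hdV dW hdW) ×
      (Π v : S, UnitaryGroup.localPi L (IsCMField.complexConj L) (n + n) (hermD L e dV hdV dW hdW) v.1) → ℂ) : Prop :=
  ∀ (s : ℂ) (h : HA L e dV hdV dW hdW),
    f s h =
      fS s (UnitaryGroup.archPart (Fp L) L (IsCMField.complexConj L) (n + n) (hermD L e dV hdV dW hdW) h,
          fun v : S => UnitaryGroup.evalPlace (Fp L) L (IsCMField.complexConj L) (n + n) (hermD L e dV hdV dW hdW) v.1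
            (UnitaryGroup.finPart (Fp L) L (IsCMField.complexConj L) (n + n) (hermD L e dV hdV dW hdW) h)) *
        ∏ᶠ v : {v : HeightOneSpectrum (𝓞 (Fp L)) // v ∉ S},
          LambdaLoc L e dV hdV dW hdW v.1 χ s
            (UnitaryGroup.evalPlace (Fp L) L (IsCMField.complexConj L) (n + n) (hermD L e dV hdV dW hdW) v.1
              (UnitaryGroup.finPart (Fp L) L (IsCMField.complexConj L) (n + n) (hermD L e dV hdV dW hdW) h))

omit [IsCMField L] in
/-- the places of `L⁺` above which `χ` ramifies form a finite set when `χ` is unramified at almost every place of `L`.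
[cite: CasselsFrohlichANT1967, Ch. II §14] -/
theorem finite_setOf_exists_not_isUnramifiedAt (χ : HeckeCharacter L)
    (hχ : ∀ᶠ w : HeightOneSpectrum (𝓞 L) in Filter.cofinite, χ.IsUnramifiedAt w) :
    {v : HeightOneSpectrum (𝓞 (Fp L)) | ∃ w : UnitaryGroup.PlacesOver L v, ¬ χ.IsUnramifiedAt w.1}.Finite := by
  have hfin : {w : HeightOneSpectrum (𝓞 L) | ¬ χ.IsUnramifiedAt w}.Finite := Filter.eventually_cofinite.1 hχ
  refine (hfin.image fun w : HeightOneSpectrum (𝓞 L) => w.under (𝓞 (Fp L))).subset ?_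
  rintro v ⟨w, hw⟩
  exact ⟨w.1, hw, w.2⟩

/-- **the off-`S` product is finitely supported**: for `h ∈ H(𝔸)` and `χ` unramified almost everywhere, `Λ_{s,v}(h_v) = 1` for almost all `v`
(`h_v ∈ K_{H,v}` for almost all `v`, ★ `eventually_evalPlace_mem_localInt`, and `Λ_{s,v} = 1` on `K_{H,v}`). [cite: Liu2011, §2B p. 862] [cite: BorelJacquet1979, §4.1] -/
theorem finite_mulSupport_lambdaLoc (S : Finset (HeightOneSpectrum (𝓞 (Fp L)))) (χ : HeckeCharacter L)
    (hχ : ∀ᶠ w : HeightOneSpectrum (𝓞 L) in Filter.cofinite, χ.IsUnramifiedAt w) (s : ℂ) (h : HA L e dV hdV dW hdW) :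
    (Function.mulSupport fun v : {v : HeightOneSpectrum (𝓞 (Fp L)) // v ∉ S} =>
      LambdaLoc L e dV hdV dW hdW v.1 χ s
        (UnitaryGroup.evalPlace (Fp L) L (IsCMField.complexConj L) (n + n) (hermD L e dV hdV dW hdW) v.1
          (UnitaryGroup.finPart (Fp L) L (IsCMField.complexConj L) (n + n) (hermD L e dV hdV dW hdW) h))).Finite := by
  have h1 : {v : HeightOneSpectrum (𝓞 (Fp L)) |
      ¬ UnitaryGroup.evalPlace (Fp L) L (IsCMField.complexConj L) (n + n) (hermD L e dV hdV dW hdW) v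
          (UnitaryGroup.finPart (Fp L) L (IsCMField.complexConj L) (n + n) (hermD L e dV hdV dW hdW) h) ∈
        UnitaryGroup.localInt L (IsCMField.complexConj L) (n + n) (hermD L e dV hdV dW hdW) v}.Finite :=
    Filter.eventually_cofinite.1 (UnitaryGroup.eventually_evalPlace_mem_localInt (Fp L) L (IsCMField.complexConj L) (n + n)
      (hermD L e dV hdV dW hdW) _)
  have h2 := finite_setOf_exists_not_isUnramifiedAt L χ hχ
  refine ((h1.union h2).preimage Subtype.val_injective.injOn).subset ?_
  intro v hv
  by_contra hcon
  simp only [Set.mem_preimage, Set.mem_union, Set.mem_setOf_eq, not_or, not_not, not_exists] at hcon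
  exact hv (lambdaLoc_of_mem_localInt L e dV hdV dW hdW v.1 χ s (fun w => hcon.2 w) hcon.1)

end Factorizable

end Literature.NumberTheory.K2Lit.SiegelDoubled

end
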